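import Summits.QuantumFields.GaugeBoot.TiltedBoxTwoDimBlocks
import Summits.QuantumFields.GaugeBoot.TiltedBoxTwoDimMidAnnulus
import Summits.QuantumFields.GaugeBoot.TiltedBoxOddMidAxisRPNegative
import HarnessLib

/-!
# The odd square tilted box in two dimensions: the reduced half of the link mirror, its positive links, three annuli (gauge-boot, L3 supplement: 2D slab gluing, reduced-half link mirror 2/4)

HONEST FRAMING (cell `pub-gaugeboot`, page 1 of every file): the venture produces certified bounds
on lattice expectations at stated coupling, gauge group, dimension and torus size; NOT a mass gap,
NOT a continuum limit, NOT a string tension; NOT Yang–Mills-summit-bearing (barriers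
`FixedCouplingUltralocality`, `PerturbativeInvisibility`). Geometric bookkeeping for the POSITIVE
two-dimensional result `TiltedBoxOddMidAxisRPTwoDim.lean`; it discharges nothing else.

Setting: the ODD square box `ℤ^d/Γ(2P+1, 2P+1, L)`, `P ≥ 1`, in two dimensions (`∀ k, k = i ∨ k = j`),
the LINK mirror `θ : x_i ↦ 1 - x_i` (`midReflect`/`configMidReflect` of the flip `tiltedAxisFlip`).
Its fixed loci are the slab `0|1` (exact) and the LAYER `x_i ≡ P + 1`, mapped onto itself twisted by
`T = [(2P+1) e_j]` (`midReflect_of_axisCoord_eq_succ`), which is why closed-half link RP for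
`{1 ≤ x_i ≤ P + 1}` fails at every `β` in every `d ≥ 2` (`not_tiltedBox_midAxisRP_odd`). This module
prepares the REDUCED half `{1 ≤ x_i ≤ P}` (`IsRedLink`: links with both endpoints in it), which leaves
the twisted layer FREE: between the half (top layer `P`) and its mirror image (bottom layer `P + 2`) sit
the two annuli `P|P+1`, `P+1|P+2` and the free layer `P + 1`; below, the exact annulus `0|1`.

* `posBlockR` — the positive links (`j`-links of the layers `1 … P`, `i`-links based in `1 … P-1`),
  `isRedLink_iff_mem_posBlockR`; the mirror reads every positive link off the complement
  (`dependsOn_configMidReflect_apply_odd`) — the hypothesis of the tree's mechanism with NO shared block;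
* the rungs `(y + t e_j, i)` of the three annuli (`x_i(y) ∈ {0, P, P+1}`) and the letters of the free
  layer are not positive, and mirror images of positive links are never rungs or free letters
  (`configMidReflect_update_rung_odd`, `configMidReflect_update_freeLetter`);
* `val` arithmetic of `x_i(σ y) = -x_i(y)`, `x_i(θ y) = 1 - x_i(y)` modulo `2P + 1`;
* `Θ_mid` preserves the product Haar measure and is continuous (odd side).

References: K. Osterwalder, E. Seiler, Ann. Phys. 110 (1978) 440, §2; J. Fröhlich, R. Israel,
E. H. Lieb, B. Simon, J. Stat. Phys. 22 (1980) 297, §3.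
-/

noncomputable section

open QuotientAddGroup Finset Function MeasureTheory

namespace Summit.QuantumFields.GaugeBoot

namespace TiltedRP

namespace TwoDim

variable {d : ℕ} {i j : Fin d} {L P : ℕ}

section OddMid

variable [NeZero L] [NeZero P]

/-! ## `val` arithmetic modulo `2P + 1` -/

omit [NeZero L] in
/-- `(b + 1).val` in `ZMod (2P+1)`: `2P ↦ 0`, otherwise `+ 1`. [folklore] -/
theorem val_add_one_eq (b : ZMod (2 * P + 1)) : (b + 1).val = if b.val = 2 * P then 0 else b.val + 1 := by
  have hM1 : 2 * P + 1 ≠ 1 := by have := NeZero.ne P; omega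
  have hb := ZMod.val_lt b
  by_cases htop : b.val = 2 * P
  · rw [if_pos htop]
    have h0 : b + 1 = 0 := by
      apply ZMod.val_injective
      rw [ZMod.val_add, htop, ZMod.val_one'' hM1, ZMod.val_zero]
      simp
    rw [h0, ZMod.val_zero]
  · rw [if_neg htop]
    have hlt : b.val + (1 : ZMod (2 * P + 1)).val < 2 * P + 1 := by rw [ZMod.val_one'' hM1]; omega
    rw [ZMod.val_add_of_lt hlt, ZMod.val_one'' hM1]

omit [NeZero L] [NeZero P] in
/-- `x_i(θ y) = -x_i(y) + 1` for the link mirror of the odd box. [folklore] -/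
theorem axisCoord_midReflect_odd (hij : i ≠ j) (q : TiltedSite d i j (2 * P + 1) (2 * P + 1) L) :
    axisCoord d L (2 * P + 1) (midReflect (tiltedUnit d i j (2 * P + 1) (2 * P + 1) L) i
      (tiltedAxisFlip d L (2 * P + 1) hij) q) = -axisCoord d L (2 * P + 1) q + 1 := by
  rw [midReflect, map_add, axisCoord_tiltedAxisFlip, axisCoord_tiltedUnit_self]

omit [NeZero L] [NeZero P] in
/-- `val` of `x_i(σ y)`: `0 ↦ 0`, `c ↦ 2P + 1 - c`. [folklore] -/
theorem val_axisCoord_tiltedAxisFlip_odd (hij : i ≠ j) (q : TiltedSite d i j (2 * P + 1) (2 * P + 1) L) :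
    (axisCoord d L (2 * P + 1) (tiltedAxisFlip d L (2 * P + 1) hij q)).val =
      if axisCoord d L (2 * P + 1) q = 0 then 0 else 2 * P + 1 - (axisCoord d L (2 * P + 1) q).val := by
  rw [axisCoord_tiltedAxisFlip, val_neg_eq]

omit [NeZero L] in
/-- `val` of `x_i(θ y)`: `0 ↦ 1`, `1 ↦ 0`, `c ↦ 2P + 2 - c` for `c ≥ 2`. [folklore] -/
theorem val_axisCoord_midReflect_odd (hij : i ≠ j) (q : TiltedSite d i j (2 * P + 1) (2 * P + 1) L) :
    (axisCoord d L (2 * P + 1) (midReflect (tiltedUnit d i j (2 * P + 1) (2 * P + 1) L) i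
      (tiltedAxisFlip d L (2 * P + 1) hij) q)).val =
      if (axisCoord d L (2 * P + 1) q).val ≤ 1 then 1 - (axisCoord d L (2 * P + 1) q).val
      else 2 * P + 2 - (axisCoord d L (2 * P + 1) q).val := by
  have hc := ZMod.val_lt (axisCoord d L (2 * P + 1) q)
  rw [axisCoord_midReflect_odd hij, val_add_one_eq, val_neg_eq]
  by_cases hz : axisCoord d L (2 * P + 1) q = 0
  · have hv : (axisCoord d L (2 * P + 1) q).val = 0 := by rw [hz, ZMod.val_zero]
    rw [if_pos hz, hv]
    have hP : 1 ≤ P := one_le_P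
    rw [if_neg (by omega), if_pos (by omega)]
  · have hv : (axisCoord d L (2 * P + 1) q).val ≠ 0 := fun h => hz ((ZMod.val_eq_zero _).1 h)
    rw [if_neg hz]
    split_ifs <;> omega

/-! ## The reduced half and its positive links -/

/-- **A link of the REDUCED half** `{1 ≤ x_i ≤ P}` of the link mirror on the odd box: both endpoints
in it (the twisted layer `x_i ≡ P + 1` is left out). -/
def IsRedLink (l : Link (TiltedSite d i j (2 * P + 1) (2 * P + 1) L) d) : Prop :=
  (1 ≤ (axisCoord d L (2 * P + 1) l.1).val ∧ (axisCoord d L (2 * P + 1) l.1).val ≤ P) ∧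
  (1 ≤ (axisCoord d L (2 * P + 1) (l.1 + tiltedUnit d i j (2 * P + 1) (2 * P + 1) L l.2)).val ∧
    (axisCoord d L (2 * P + 1) (l.1 + tiltedUnit d i j (2 * P + 1) (2 * P + 1) L l.2)).val ≤ P)

/-- The POSITIVE links of the reduced half: `j`-links of the layers `1 … P` and `i`-links based in
the layers `1 … P-1`. -/
def posBlockR (d : ℕ) (i j : Fin d) (L P : ℕ) [NeZero L] :
    Finset (Link (TiltedSite d i j (2 * P + 1) (2 * P + 1) L) d) :=
  Finset.univ.filter fun l =>
    (l.2 = j ∧ 1 ≤ (axisCoord d L (2 * P + 1) l.1).val ∧ (axisCoord d L (2 * P + 1) l.1).val ≤ P) ∨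
    (l.2 = i ∧ 1 ≤ (axisCoord d L (2 * P + 1) l.1).val ∧ (axisCoord d L (2 * P + 1) l.1).val + 1 ≤ P)

omit [NeZero P] in
/-- Membership in the positive block. [folklore] -/
theorem mem_posBlockR {l : Link (TiltedSite d i j (2 * P + 1) (2 * P + 1) L) d} :
    l ∈ posBlockR d i j L P ↔
      (l.2 = j ∧ 1 ≤ (axisCoord d L (2 * P + 1) l.1).val ∧ (axisCoord d L (2 * P + 1) l.1).val ≤ P) ∨
      (l.2 = i ∧ 1 ≤ (axisCoord d L (2 * P + 1) l.1).val ∧ (axisCoord d L (2 * P + 1) l.1).val + 1 ≤ P) := by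
  simp [posBlockR]

/-- **The links of the reduced half are the positive block** (two dimensions). [folklore] -/
theorem isRedLink_iff_mem_posBlockR (hij : i ≠ j) (hd : ∀ k : Fin d, k = i ∨ k = j)
    (l : Link (TiltedSite d i j (2 * P + 1) (2 * P + 1) L) d) :
    IsRedLink l ↔ l ∈ posBlockR d i j L P := by
  obtain ⟨x, k⟩ := l
  have hc := ZMod.val_lt (axisCoord d L (2 * P + 1) x)
  rw [mem_posBlockR, IsRedLink, axisCoord_add_tiltedUnit]
  simp only
  rcases hd k with hk | hk
  · rw [hk, if_pos rfl, val_add_one_eq]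
    simp only [hij, false_and, false_or, true_and]
    by_cases h : (axisCoord d L (2 * P + 1) x).val = 2 * P
    · rw [if_pos h]; omega
    · rw [if_neg h]; omega
  · rw [hk, if_neg (Ne.symm hij), add_zero]
    simp only [Ne.symm hij, false_and, or_false, true_and]
    omega

/-- **The mirror reads a positive link off the complement of the positive block.** [folklore] -/
theorem midLinkMap_not_mem_posBlockR (hij : i ≠ j) (hd : ∀ k : Fin d, k = i ∨ k = j)
    {l : Link (TiltedSite d i j (2 * P + 1) (2 * P + 1) L) d} (hl : l ∈ posBlockR d i j L P) :
    midLinkMap (tiltedUnit d i j (2 * P + 1) (2 * P + 1) L) i (tiltedAxisFlip d L (2 * P + 1) hij) l ∉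
      posBlockR d i j L P := by
  obtain ⟨x, k⟩ := l
  intro hmem
  have hc := ZMod.val_lt (axisCoord d L (2 * P + 1) x)
  rcases hd k with hk | hk
  · -- `i`-link: image `(σ x, i)`, coordinate `-x_i`
    rw [hk] at hl hmem
    rw [midLinkMap_self, mem_posBlockR] at hmem
    rw [mem_posBlockR] at hl
    simp only [hij, false_and, false_or, true_and] at hl hmem
    rw [val_axisCoord_tiltedAxisFlip_odd hij] at hmem
    split_ifs at hmem with h0 <;> omega
  · -- `j`-link: image `(θ x, j)`, coordinate `1 - x_i`
    rw [hk] at hl hmem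
    rw [midLinkMap_other _ i _ x (Ne.symm hij), mem_posBlockR] at hmem
    rw [mem_posBlockR] at hl
    simp only [Ne.symm hij, false_and, or_false, true_and] at hl hmem
    rw [val_axisCoord_midReflect_odd hij] at hmem
    split_ifs at hmem with h1 <;> omega

/-- The reflected value of a positive link depends only on the links off the positive block. [folklore] -/
theorem dependsOn_configMidReflect_apply_odd {G : Type*} [Group G]
    [DecidableEq (TiltedSite d i j (2 * P + 1) (2 * P + 1) L)] (hij : i ≠ j) (hd : ∀ k : Fin d, k = i ∨ k = j)
    (l : Link (TiltedSite d i j (2 * P + 1) (2 * P + 1) L) d) (hl : l ∈ posBlockR d i j L P ∪ ∅) :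
    DependsOn (fun U : Config (TiltedSite d i j (2 * P + 1) (2 * P + 1) L) d G =>
        configMidReflect (tiltedUnit d i j (2 * P + 1) (2 * P + 1) L) i (tiltedAxisFlip d L (2 * P + 1) hij) U l)
      (((posBlockR d i j L P)ᶜ : Finset _) : Set _) := by
  rw [Finset.union_empty] at hl
  intro U V h
  have hmem : midLinkMap (tiltedUnit d i j (2 * P + 1) (2 * P + 1) L) i (tiltedAxisFlip d L (2 * P + 1) hij) l ∈
      (((posBlockR d i j L P)ᶜ : Finset _) : Set _) := by
    rw [Finset.coe_compl, Set.mem_compl_iff, Finset.mem_coe]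
    exact midLinkMap_not_mem_posBlockR hij hd hl
  have hUV := h _ hmem
  show configMidReflect _ i _ U l = configMidReflect _ i _ V l
  unfold configMidReflect
  split_ifs <;> simp [hUV]

/-- The `j`-links of the layers `1` and `P` (the letters of the lower and upper annulus words on the
positive side) are positive links (`P ≥ 1`). [folklore] -/
theorem jLink_mem_posBlockR {x : TiltedSite d i j (2 * P + 1) (2 * P + 1) L}
    (hx : (axisCoord d L (2 * P + 1) x).val = 1 ∨ (axisCoord d L (2 * P + 1) x).val = P) :
    (x, j) ∈ posBlockR d i j L P := by
  have hP : 1 ≤ P := one_le_P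
  rw [mem_posBlockR]
  refine Or.inl ⟨rfl, ?_⟩
  show 1 ≤ (axisCoord d L (2 * P + 1) x).val ∧ (axisCoord d L (2 * P + 1) x).val ≤ P
  omega

/-! ## The rungs of the three annuli and the letters of the free layer -/

omit [NeZero P] in
/-- An `i`-link based in the layer `0`, `P` or `P + 1` (a rung of one of the three annuli) is not a
positive link. [folklore] -/
theorem iLink_not_mem_posBlockR (hij : i ≠ j) {x : TiltedSite d i j (2 * P + 1) (2 * P + 1) L}
    (hx : (axisCoord d L (2 * P + 1) x).val = 0 ∨ (axisCoord d L (2 * P + 1) x).val = P ∨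
      (axisCoord d L (2 * P + 1) x).val = P + 1) :
    (x, i) ∉ posBlockR d i j L P := by
  rw [mem_posBlockR]
  simp only [hij, false_and, false_or, true_and]
  omega

omit [NeZero P] in
/-- A `j`-link of the free layer `x_i ≡ P + 1` is not a positive link. [folklore] -/
theorem freeLetter_not_mem_posBlockR (hij : i ≠ j) {x : TiltedSite d i j (2 * P + 1) (2 * P + 1) L}
    (hx : (axisCoord d L (2 * P + 1) x).val = P + 1) : (x, j) ∉ posBlockR d i j L P := by
  rw [mem_posBlockR]
  simp only [Ne.symm hij, false_and, or_false, true_and]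
  omega

omit [NeZero P] in
/-- **The mirror image of a positive link is never a rung** (a `j`-link, or an `i`-link `(σ x, i)`
with `x_i(σ x) = 2P + 1 - x_i(x) ≥ P + 2`). [folklore] -/
theorem midLinkMap_ne_rung_odd (hij : i ≠ j) (hd : ∀ k : Fin d, k = i ∨ k = j)
    {l : Link (TiltedSite d i j (2 * P + 1) (2 * P + 1) L) d} (hl : l ∈ posBlockR d i j L P)
    {y : TiltedSite d i j (2 * P + 1) (2 * P + 1) L}
    (hy : (axisCoord d L (2 * P + 1) y).val = 0 ∨ (axisCoord d L (2 * P + 1) y).val = P ∨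
      (axisCoord d L (2 * P + 1) y).val = P + 1) (s : ℕ) :
    midLinkMap (tiltedUnit d i j (2 * P + 1) (2 * P + 1) L) i (tiltedAxisFlip d L (2 * P + 1) hij) l ≠ (cyc y s, i) := by
  obtain ⟨x, k⟩ := l
  rcases hd k with hk | hk
  · rw [hk] at hl ⊢
    rw [midLinkMap_self]
    intro h
    rw [mem_posBlockR] at hl
    simp only [hij, false_and, false_or, true_and] at hl
    have h1 := congrArg (fun l => (axisCoord d L (2 * P + 1) l.1).val) h
    simp only [axisCoord_cyc hij, val_axisCoord_tiltedAxisFlip_odd hij] at h1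
    by_cases h0 : axisCoord d L (2 * P + 1) x = 0
    · have hv : (axisCoord d L (2 * P + 1) x).val = 0 := by rw [h0, ZMod.val_zero]
      omega
    · rw [if_neg h0] at h1
      have hc := ZMod.val_lt (axisCoord d L (2 * P + 1) x)
      omega
  · rw [hk, midLinkMap_other _ i _ x (Ne.symm hij)]
    exact fun h => hij (congrArg Prod.snd h).symm

/-- **The mirror image of a positive link is never a letter of the free layer** (`x_i(θ x) ∈
{0} ∪ [P + 2, 2P]` for `1 ≤ x_i(x) ≤ P`). [folklore] -/
theorem midLinkMap_ne_freeLetter (hij : i ≠ j) (hd : ∀ k : Fin d, k = i ∨ k = j)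
    {l : Link (TiltedSite d i j (2 * P + 1) (2 * P + 1) L) d} (hl : l ∈ posBlockR d i j L P)
    {x : TiltedSite d i j (2 * P + 1) (2 * P + 1) L} (hx : (axisCoord d L (2 * P + 1) x).val = P + 1) :
    midLinkMap (tiltedUnit d i j (2 * P + 1) (2 * P + 1) L) i (tiltedAxisFlip d L (2 * P + 1) hij) l ≠ (x, j) := by
  obtain ⟨x', k⟩ := l
  rcases hd k with hk | hk
  · rw [hk, midLinkMap_self]
    exact fun h => hij (congrArg Prod.snd h)
  · rw [hk] at hl ⊢
    rw [midLinkMap_other _ i _ x' (Ne.symm hij)]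
    intro h
    rw [mem_posBlockR] at hl
    simp only [Ne.symm hij, false_and, or_false, true_and] at hl
    have h1 := congrArg (fun l => (axisCoord d L (2 * P + 1) l.1).val) h
    simp only [val_axisCoord_midReflect_odd hij, hx] at h1
    split_ifs at h1 <;> omega

omit [NeZero P] in
/-- Updating a rung does not change the positive links. [folklore] -/
theorem update_rung_apply_of_mem {G : Type*} [DecidableEq (TiltedSite d i j (2 * P + 1) (2 * P + 1) L)] (hij : i ≠ j)
    (U : Config (TiltedSite d i j (2 * P + 1) (2 * P + 1) L) d G) {y : TiltedSite d i j (2 * P + 1) (2 * P + 1) L}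
    (hy : (axisCoord d L (2 * P + 1) y).val = 0 ∨ (axisCoord d L (2 * P + 1) y).val = P ∨
      (axisCoord d L (2 * P + 1) y).val = P + 1) (s : ℕ) (z : G)
    (l : Link (TiltedSite d i j (2 * P + 1) (2 * P + 1) L) d) (hl : l ∈ posBlockR d i j L P) :
    update U (cyc y s, i) z l = U l := by
  rw [update_of_ne]
  rintro rfl
  exact iLink_not_mem_posBlockR hij (by rw [axisCoord_cyc hij]; exact hy) hl

omit [NeZero P] in
/-- Updating a rung does not change the REFLECTED positive links. [folklore] -/
theorem configMidReflect_update_rung_odd {G : Type*} [Group G] [DecidableEq (TiltedSite d i j (2 * P + 1) (2 * P + 1) L)]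
    (hij : i ≠ j) (hd : ∀ k : Fin d, k = i ∨ k = j)
    (U : Config (TiltedSite d i j (2 * P + 1) (2 * P + 1) L) d G) {y : TiltedSite d i j (2 * P + 1) (2 * P + 1) L}
    (hy : (axisCoord d L (2 * P + 1) y).val = 0 ∨ (axisCoord d L (2 * P + 1) y).val = P ∨
      (axisCoord d L (2 * P + 1) y).val = P + 1) (s : ℕ) (z : G)
    (l : Link (TiltedSite d i j (2 * P + 1) (2 * P + 1) L) d) (hl : l ∈ posBlockR d i j L P) :
    configMidReflect (tiltedUnit d i j (2 * P + 1) (2 * P + 1) L) i (tiltedAxisFlip d L (2 * P + 1) hij)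
        (update U (cyc y s, i) z) l =
      configMidReflect (tiltedUnit d i j (2 * P + 1) (2 * P + 1) L) i (tiltedAxisFlip d L (2 * P + 1) hij) U l := by
  unfold configMidReflect
  rw [update_of_ne (midLinkMap_ne_rung_odd hij hd hl hy s)]

omit [NeZero P] in
/-- Updating a letter of the free layer does not change the positive links. [folklore] -/
theorem update_freeLetter_apply_of_mem {G : Type*} [DecidableEq (TiltedSite d i j (2 * P + 1) (2 * P + 1) L)] (hij : i ≠ j)
    (U : Config (TiltedSite d i j (2 * P + 1) (2 * P + 1) L) d G) {x : TiltedSite d i j (2 * P + 1) (2 * P + 1) L}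
    (hx : (axisCoord d L (2 * P + 1) x).val = P + 1) (z : G)
    (l : Link (TiltedSite d i j (2 * P + 1) (2 * P + 1) L) d) (hl : l ∈ posBlockR d i j L P) :
    update U (x, j) z l = U l := by
  rw [update_of_ne]
  rintro rfl
  exact freeLetter_not_mem_posBlockR hij hx hl

/-- Updating a letter of the free layer does not change the REFLECTED positive links. [folklore] -/
theorem configMidReflect_update_freeLetter {G : Type*} [Group G] [DecidableEq (TiltedSite d i j (2 * P + 1) (2 * P + 1) L)]
    (hij : i ≠ j) (hd : ∀ k : Fin d, k = i ∨ k = j)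
    (U : Config (TiltedSite d i j (2 * P + 1) (2 * P + 1) L) d G) {x : TiltedSite d i j (2 * P + 1) (2 * P + 1) L}
    (hx : (axisCoord d L (2 * P + 1) x).val = P + 1) (z : G)
    (l : Link (TiltedSite d i j (2 * P + 1) (2 * P + 1) L) d) (hl : l ∈ posBlockR d i j L P) :
    configMidReflect (tiltedUnit d i j (2 * P + 1) (2 * P + 1) L) i (tiltedAxisFlip d L (2 * P + 1) hij)
        (update U (x, j) z) l =
      configMidReflect (tiltedUnit d i j (2 * P + 1) (2 * P + 1) L) i (tiltedAxisFlip d L (2 * P + 1) hij) U l := by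
  unfold configMidReflect
  rw [update_of_ne (midLinkMap_ne_freeLetter hij hd hl hx)]

/-! ## The base sites of the three annuli -/

omit [NeZero L] [NeZero P] in
/-- `x_i(y₀) = P` as a natural number, `y₀ = [P e_i]`. [folklore] -/
theorem val_axisCoord_oddLayerSite : (axisCoord d L (2 * P + 1) (oddLayerSite d i j L P)).val = P := by
  rw [axisCoord_oddLayerSite, ZMod.val_natCast, Nat.mod_eq_of_lt (by omega)]

omit [NeZero L] in
/-- `x_i(y₀ + e_i) = P + 1`: the base site of the free layer. [folklore] -/
theorem val_axisCoord_oddLayerSite_add :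
    (axisCoord d L (2 * P + 1) (oddLayerSite d i j L P + tiltedUnit d i j (2 * P + 1) (2 * P + 1) L i)).val = P + 1 := by
  have hP : 1 ≤ P := one_le_P
  rw [axisCoord_add_tiltedUnit, if_pos rfl, val_add_one_of_le (by rw [val_axisCoord_oddLayerSite]) hP,
    val_axisCoord_oddLayerSite]

omit [NeZero L] [NeZero P] in
/-- `x_i(y₀ + e_i) = x_i(y₀) + 1` in `ZMod (2P+1)`. [folklore] -/
theorem axisCoord_oddLayerSite_add :
    axisCoord d L (2 * P + 1) (oddLayerSite d i j L P + tiltedUnit d i j (2 * P + 1) (2 * P + 1) L i) =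
      ((P : ℕ) : ZMod (2 * P + 1)) + 1 := by
  rw [axisCoord_add_tiltedUnit, if_pos rfl, axisCoord_oddLayerSite]

omit [NeZero L] [NeZero P] in
/-- The letters of the free layer along the third annulus: `x_i(cyc (y₀ + e_i) t) = P + 1`. [folklore] -/
theorem val_axisCoord_cyc_oddLayerSite_add [NeZero P] (hij : i ≠ j) (t : ℕ) :
    (axisCoord d L (2 * P + 1) (cyc (oddLayerSite d i j L P + tiltedUnit d i j (2 * P + 1) (2 * P + 1) L i) t)).val
      = P + 1 := by
  rw [axisCoord_cyc hij, val_axisCoord_oddLayerSite_add]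

end OddMid

/-! ## The link mirror of the odd box: measure preservation and continuity -/

section Measure

variable {P : ℕ} [NeZero L] {G : Type*} [Group G] [TopologicalSpace G] [IsTopologicalGroup G] [CompactSpace G]
  [MeasurableSpace G] [BorelSpace G]

/-- **`Θ_mid` preserves the product Haar measure** on the odd box (`Θ_mid = Θ_site ∘ τ_{e_i}`). [folklore] -/
theorem measurePreserving_configMidReflect_flip_odd (hij : i ≠ j) :
    MeasurePreserving (configMidReflect (G := G) (tiltedUnit d i j (2 * P + 1) (2 * P + 1) L) i
        (tiltedAxisFlip d L (2 * P + 1) hij))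
      (productHaar (TiltedSite d i j (2 * P + 1) (2 * P + 1) L) d G)
      (productHaar (TiltedSite d i j (2 * P + 1) (2 * P + 1) L) d G) := by
  have he : configMidReflect (G := G) (tiltedUnit d i j (2 * P + 1) (2 * P + 1) L) i (tiltedAxisFlip d L (2 * P + 1) hij) =
      configReflect (tiltedUnit d i j (2 * P + 1) (2 * P + 1) L) i (tiltedAxisFlip d L (2 * P + 1) hij) ∘
        translate (tiltedUnit d i j (2 * P + 1) (2 * P + 1) L i) :=
    funext fun U => configMidReflect_eq_configReflect_translate _ i _ U
  rw [he]
  exact ((isAxisFlip_tiltedAxisFlip d L (2 * P + 1) hij).measurePreserving_configReflect (G := G)).comp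
    (measurePreserving_translate _)

omit [NeZero L] [CompactSpace G] [MeasurableSpace G] [BorelSpace G] in
/-- `Θ_mid` is continuous on the odd box. [folklore] -/
theorem continuous_configMidReflect_flip_odd (hij : i ≠ j) :
    Continuous (configMidReflect (G := G) (tiltedUnit d i j (2 * P + 1) (2 * P + 1) L) i
      (tiltedAxisFlip d L (2 * P + 1) hij)) := by
  refine continuous_pi fun l => ?_
  unfold configMidReflect
  split_ifs
  · exact (continuous_apply _).inv
  · exact continuous_apply _

end Measure

end TwoDim

end TiltedRP

end Summit.QuantumFields.GaugeBoot

end
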